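import Summits.BirchSwinnertonDyer.BirchSwinnertonDyer.Theses.ManinLocalTwoThree
import HarnessLib

/-!
# Route `ManinLocalTwoThree` (cell `bsd-f2-manin`): the GLUE item `PrintedSemistableManinFactsOfParts`
# (stmt-BirchSwinnertonDyer-23061) PROVED — the support bundle `PrintedSemistableManinFacts`
# (stmt-BirchSwinnertonDyer-22970) is the conjunction of its four item-stated children
# (`MazurManinConstantOddPrimes` 19383, `AbbesUllmoManinConstantGoodPrimes` 20090,
# `CesnaviciusManinConstantAtTwo` 20091, `NewformOfEllipticCurve` 19382). Pure logic (`And.intro` ×3);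
# typed by the cell typer at the planner-of-record's request (imc g8, 2026-08-27T22:16Z), landed by prover
# seat bsd-line-manin23-p3. Nothing about BSD
# or Manin's conjecture is proved here.
-/

set_option autoImplicit false
set_option linter.dupNamespace false

noncomputable section

namespace Summit.BirchSwinnertonDyer.BirchSwinnertonDyer.Theorems

open Summit.BirchSwinnertonDyer.BirchSwinnertonDyer.Theses.ManinLocalTwoThree

/-- **Glue (stmt-BirchSwinnertonDyer-23061), PROVED:** `MazurManinConstantOddPrimes →
AbbesUllmoManinConstantGoodPrimes → CesnaviciusManinConstantAtTwo → NewformOfEllipticCurve →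
PrintedSemistableManinFacts` — the parent is by definition the conjunction of the four children.
[folklore] -/
theorem maninLocalTwoThree_printedSemistableManinFactsOfParts_proof :
    Summit.BirchSwinnertonDyer.BirchSwinnertonDyer.Theses.ManinLocalTwoThree.PrintedSemistableManinFactsOfParts := by
  unfold Summit.BirchSwinnertonDyer.BirchSwinnertonDyer.Theses.ManinLocalTwoThree.PrintedSemistableManinFactsOfParts
    Summit.BirchSwinnertonDyer.BirchSwinnertonDyer.Theses.ManinLocalTwoThree.PrintedSemistableManinFacts
  exact fun hM hAU hC hnf ↦ ⟨hM, hAU, hC, hnf⟩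

end Summit.BirchSwinnertonDyer.BirchSwinnertonDyer.Theorems

end
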